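import Literature.NumberTheory.Automorphic.PairLFunctionPolesGLOneProofs
import Literature.NumberTheory.GaloisRepresentations.HeckeLFunctionAnalyticProofs
import Literature.NumberTheory.LFunctions.AutomorphicGRHProofs
import Mathlib.NumberTheory.LSeries.Nonvanishing
import Mathlib.NumberTheory.EulerProduct.DirichletLSeries
import HarnessLib

/-!
# Arthur–Clozel (2.2)–(2.3) for `GL_1` over `ℚ`, unconditionally (proofs only)

Topic `NumberTheory/Automorphic`; namespace `Literature.NumberTheory.Automorphic` (with lemmas on
Hecke characters in `Literature.NumberTheory.GaloisRepresentations`). Proof file (theorems only: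
no definition, no named fact, no instance) under the named fact
`JacquetShalika1981_partialPairL_at_one_of_ne_conj` of `PairLFunctionPoles` — Arthur–Clozel,
*Simple algebras, base change, and the advanced theory of the trace formula*, Ann. of Math.
Stud. 120 (1989), Ch. 3 §2, (2.2), p. 171, at `s₀ = 1` ("`L^S(s, π ⊗ σ)` extends continuously to
`s = 1` with non-zero value when `π ≇ σ̃`") — proving it outright in the first case the tree can
reach: **rank `n = 1` over `K = ℚ`** (`JacquetShalika1981_partialPairL_at_one_of_ne_conj_one_rat`).

There a cuspidal automorphic representation of `GL_1(𝔸_ℚ)` is a unitary character `χ` of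
`𝔸_ℚˣ / ℚˣ ℝ_{>0} ≅ ẑˣ`, i.e. (a primitive) Dirichlet character, `L^S(s, π × π') = L^S(s, χχ')`,
and (2.2) at `s = 1` is Dirichlet's theorem `L(1, ψ) ≠ 0` for `ψ = χχ' ≠ 1` together with the
holomorphy of `L(s, ψ)` at `s = 1` — both in Mathlib (`DirichletCharacter.LFunction_ne_zero_of_one_le_re`,
`DirichletCharacter.differentiable_LFunction`). The file supplies the dictionary:

* (from `AutomorphicGRHProofs`, reused: `AutomorphicGRHOne.isFiniteOrder_of_map_posRealIdele` —
  **a Hecke character of `ℚ` trivial on `ℝ_{>0}` has finite order**, `𝕀_ℚ = ℚˣ × ℝ_{>0} × ẑˣ`,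
  Neukirch Ch. VI §1, Prop. (1.9); so it comes from a Dirichlet character,
  `HeckeCharacter.exists_dirichletCharacter_of_isFiniteOrder_holds`, and is trivial as soon as
  `ψ(ϖ_p) = 1` for almost all `p`, `HeckeCharacter.Rat.eq_one_of_forall`);
* `tprod_eulerFactor_eq_LSeries_mul_prod` — for such `ψ` with Dirichlet character `d` mod `m`
  and any finite set `S` of primes,
  **`L^S(s, ψ) = L(s, d_N) · ∏_{p ∉ S, p ∣ m} (1 - ψ(ϖ_p) p^{-s})⁻¹`** on `Re s > 1`, where `d_N` is
  `d` made imprimitive at the primes of `S` (`N = m ∏_{p ∈ S} p`; Mathlib's Euler product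
  `DirichletCharacter.LSeries_eulerProduct_hasProd`, reindexed along
  `Rat.HeightOneSpectrum.primesEquiv`);
* `heckeLandau_rat` — **Hecke–Landau for `ℚ` in limit form**: for unitary `ψ ≠ 1` trivial on
  `ℝ_{>0}` and `Re s₀ ≥ 1`, `L^S(s, ψ) → L(s₀, d_N) · ∏ (…) ≠ 0` as `s → s₀`, `Re s > 1` (Dirichlet
  (1837); Mathlib);
* `JacquetShalika1981_partialPairL_at_one_of_ne_conj_one_rat` — **the named fact for `n = 1`,
  `K = ℚ`**, by the reduction `JacquetShalika1981_partialPairL_at_one_of_ne_conj_one_of_heckeCharacter`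
  of `PairLFunctionPolesGLOneProofs`;
* the companions of `PairLFunctionPoles` in the same case: `tprod_eulerFactor_one_eq_riemannZeta_mul_prod`
  (`ζ^S(s) = ζ(s) ∏_{p ∈ S} (1 - p^{-s})`), `tendsto_sub_one_mul_tprod_eulerFactor_one` (simple pole
  of `ζ^S` at `1`, Mathlib `riemannZeta_residue_one`), `tendsto_tprod_eulerFactor_one_of_ne_one`
  (`ζ^S(1 + it) ≠ 0`, Mathlib `riemannZeta_ne_zero_of_one_le_re`), whence
  `JacquetShalika1981_partialPairL_pole_of_eq_conj_one_rat` (**(2.3)** for `n = 1`, `K = ℚ`) and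
  `JacquetShalika1981_partialPairL_boundary_of_ne_one_one_rat` (**(2.2) off `s = 1`** for
  `n = m = 1`, `K = ℚ`); `JacquetShalika1981_partialPairL_at_one_of_rank_ne` is vacuous for
  `n = m = 1`, so all four facts of `PairLFunctionPoles` hold in rank one over `ℚ`.

## References

* J. Arthur, L. Clozel, *Simple algebras, base change, and the advanced theory of the trace
  formula*, Ann. of Math. Stud. 120 (1989), Ch. 3 §2, (2.2), p. 171. [ArthurClozelAMS120]
* J. Neukirch, *Algebraic Number Theory*, Grundlehren 322 (1999), Ch. VI §1, Prop. (1.9);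
  Ch. VII §6, Def. (6.11) and Prop. (6.9). [NeukirchANT1999]
* P. G. L. Dirichlet, *Beweis des Satzes, dass jede unbegrenzte arithmetische Progression …
  unendlich viele Primzahlen enthält*, Abh. Akad. Berlin (1837) (`L(1, χ) ≠ 0`; Mathlib
  `Mathlib.NumberTheory.LSeries.Nonvanishing`).
-/

noncomputable section

open scoped MatrixGroups Topology NNReal LSeries.notation
open NumberField IsDedekindDomain MeasureTheory Filter Complex

namespace Literature.NumberTheory.GaloisRepresentations

section Rat

open Rat.HeightOneSpectrum Literature.NumberTheory.Automorphic

/-! ### Partial Hecke `L`-functions of `ℚ` are Dirichlet `L`-functions up to finitely many factors -/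

/-- **`L^S(s, ψ) = L(s, d_N) · ∏_{p ∉ S, p ∣ m} (1 - ψ(ϖ_p) p^{-s})⁻¹` on `Re s > 1`.** Let `ψ` be a
Hecke character of `ℚ` matching the Dirichlet character `d` mod `m` at the primes `p ∤ m`
(`ψ(ϖ_p) = d(p)`, as produced by `exists_dirichletCharacter_of_isFiniteOrder`), `S` a finite set of
places, `N = m ∏_{v ∈ S} p_v` and `d_N` the character `d` regarded mod `N`. Then the partial Euler
product of `ψ` off `S` is Mathlib's Euler product of `L(s, d_N)`
(`DirichletCharacter.LSeries_eulerProduct_hasProd`, reindexed along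
`Rat.HeightOneSpectrum.primesEquiv`; `d_N(p) = 0` exactly at the primes of `m` and of `S`) times
the finitely many Euler factors of `ψ` at the places `v ∉ S` over primes of `m`. [folklore] -/
theorem tprod_eulerFactor_eq_LSeries_mul_prod (ψ : HeckeCharacter ℚ) {m : ℕ} [NeZero m]
    (d : DirichletCharacter ℂ m)
    (hd : ∀ v : HeightOneSpectrum (𝓞 ℚ), (m : 𝓞 ℚ) ∉ v.asIdeal →
      ψ.IsUnramifiedAt v ∧ ψ.valueAtUniformizer v = d (v.residueCard : ZMod m))
    {S : Set (HeightOneSpectrum (𝓞 ℚ))} (hS : S.Finite)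
    {F : Set (HeightOneSpectrum (𝓞 ℚ))} (hF : F.Finite)
    (hFdef : ∀ v, v ∈ F ↔ v ∉ S ∧ natGenerator v ∣ m) {s : ℂ} (hs : 1 < s.re) :
    ∏' v : {v : HeightOneSpectrum (𝓞 ℚ) // v ∉ S},
        (1 - ψ.valueAtUniformizer v.1 * ((v.1.residueCard : ℂ) ^ (-s)))⁻¹ =
      L ↗(DirichletCharacter.changeLevel (dvd_mul_right m (∏ v ∈ hS.toFinset, natGenerator v)) d) s *
        ∏ v ∈ hF.toFinset, (1 - ψ.valueAtUniformizer v * ((v.residueCard : ℂ) ^ (-s)))⁻¹ := by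
  classical
  set P : ℕ := ∏ v ∈ hS.toFinset, natGenerator v with hP
  set d' : DirichletCharacter ℂ (m * P) := DirichletCharacter.changeLevel (dvd_mul_right m P) d
    with hd'
  -- the Euler factors of `ψ`
  set g : HeightOneSpectrum (𝓞 ℚ) → ℂ := fun v =>
    (1 - ψ.valueAtUniformizer v * ((v.residueCard : ℂ) ^ (-s)))⁻¹ with hg
  -- arithmetic of the level
  have hres : ∀ v : HeightOneSpectrum (𝓞 ℚ), v.residueCard = natGenerator v :=
    Rat.residueCard_eq_natGenerator
  have hdvd_of_mem : ∀ v ∈ S, natGenerator v ∣ m * P := fun v hv =>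
    (Finset.dvd_prod_of_mem natGenerator (hS.mem_toFinset.2 hv)).mul_left m
  have hndvd : ∀ v ∉ S, ¬ natGenerator v ∣ m → ¬ natGenerator v ∣ m * P := by
    intro v hv hvm h
    rcases (Nat.Prime.dvd_mul (prime_natGenerator v)).1 h with h' | h'
    · exact hvm h'
    · obtain ⟨w, hw, hpw⟩ :=
        (Prime.dvd_finsetProd_iff (Nat.prime_iff.mp (prime_natGenerator v)) _).1 h'
      have hvw : v = w := Rat.natGenerator_injective
        ((Nat.prime_dvd_prime_iff_eq (prime_natGenerator v) (prime_natGenerator w)).1 hpw)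
      exact hv (hvw ▸ hS.mem_toFinset.1 hw)
  have hd'_of_dvd : ∀ {p : ℕ}, p.Prime → p ∣ m * P → d' p = 0 := by
    intro p hp hpN
    have : ¬ IsUnit (p : ZMod (m * P)) := by rwa [ZMod.isUnit_prime_iff_not_dvd hp, not_not]
    exact MulChar.map_nonunit _ this
  have hd'_of_not_dvd : ∀ {p : ℕ}, p.Prime → ¬ p ∣ m * P → d' p = d p := by
    intro p hp hpN
    have hq : IsUnit (p : ZMod (m * P)) := (ZMod.isUnit_prime_iff_not_dvd hp).mpr hpN
    rw [← hq.unit_spec, hd', DirichletCharacter.changeLevel_eq_cast_of_dvd d _ hq.unit,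
      hq.unit_spec, ZMod.cast_natCast (dvd_mul_right m P)]
  -- Mathlib's Euler product of `L(s, d')`, indexed by the places of `ℚ`
  set U : Set (HeightOneSpectrum (𝓞 ℚ)) := {v | v ∉ S ∧ ¬ natGenerator v ∣ m} with hU
  have hEuler : HasProd (U.mulIndicator g) (L ↗d' s) := by
    have h := (Equiv.hasProd_iff (primesEquiv (R := 𝓞 ℚ))).2
      (DirichletCharacter.LSeries_eulerProduct_hasProd d' hs)
    refine h.congr_fun fun v => ?_
    change U.mulIndicator g v = (1 - d' (natGenerator v) * ((natGenerator v : ℂ) ^ (-s)))⁻¹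
    symm
    by_cases hvU : v ∈ U
    · rw [Set.mulIndicator_of_mem hvU, hg]
      dsimp only
      rw [hres v, hd'_of_not_dvd (prime_natGenerator v) (hndvd v hvU.1 hvU.2),
        (hd v ((Rat.natCast_mem_asIdeal_iff v).not.2 hvU.2)).2, hres v]
    · rw [Set.mulIndicator_of_notMem hvU]
      have hvN : natGenerator v ∣ m * P := by
        by_cases hvS : v ∈ S
        · exact hdvd_of_mem v hvS
        · have hvm : natGenerator v ∣ m := by
            by_contra hvm
            exact hvU ⟨hvS, hvm⟩
          exact hvm.mul_right P
      rw [hd'_of_dvd (prime_natGenerator v) hvN, zero_mul, sub_zero, inv_one]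
  -- the finitely many factors at `F`
  have hFin : HasProd (F.mulIndicator g) (∏ v ∈ hF.toFinset, g v) := by
    have h : HasProd (F.mulIndicator g) (∏ v ∈ hF.toFinset, F.mulIndicator g v) :=
      hasProd_prod_of_ne_finset_one fun v hv =>
        Set.mulIndicator_of_notMem (fun hvF => hv (hF.mem_toFinset.2 hvF)) g
    rwa [Finset.prod_congr rfl fun v hv => Set.mulIndicator_of_mem (hF.mem_toFinset.1 hv) g] at h
  -- assemble
  have hsplit : ∀ v, Sᶜ.mulIndicator g v = U.mulIndicator g v * F.mulIndicator g v := by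
    intro v
    by_cases hvS : v ∈ S
    · rw [Set.mulIndicator_of_notMem (fun h => (Set.mem_compl_iff S v).1 h hvS),
        Set.mulIndicator_of_notMem (fun h : v ∈ U => h.1 hvS),
        Set.mulIndicator_of_notMem (fun h => ((hFdef v).1 h).1 hvS), one_mul]
    · rw [Set.mulIndicator_of_mem (Set.mem_compl hvS)]
      by_cases hvm : natGenerator v ∣ m
      · rw [Set.mulIndicator_of_notMem (fun h : v ∈ U => h.2 hvm),
          Set.mulIndicator_of_mem ((hFdef v).2 ⟨hvS, hvm⟩), one_mul]
      · rw [Set.mulIndicator_of_mem (show v ∈ U from ⟨hvS, hvm⟩),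
          Set.mulIndicator_of_notMem (fun h => hvm ((hFdef v).1 h).2), mul_one]
  calc ∏' v : {v : HeightOneSpectrum (𝓞 ℚ) // v ∉ S}, g v.1
      = ∏' v, Sᶜ.mulIndicator g v := tprod_subtype Sᶜ g
    _ = ∏' v, U.mulIndicator g v * F.mulIndicator g v := tprod_congr hsplit
    _ = L ↗d' s * ∏ v ∈ hF.toFinset, g v := (hEuler.mul hFin).tprod_eq

/-! ### The partial Riemann zeta function off a finite set of places -/

/-- `1(ϖ_v) = 1` for the trivial Hecke character (a private copy of
`HeckeCharacter.valueAtUniformizer_one` of `ArtinLFunctionsAbelianProofs`, not imported here to keep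
the import closure small). [folklore] -/
private theorem HeckeCharacter.valueAtUniformizer_one' {K : Type*} [Field K] [NumberField K]
    (v : HeightOneSpectrum (𝓞 K)) : (1 : HeckeCharacter K).valueAtUniformizer v = 1 := by
  rw [HeckeCharacter.valueAtUniformizer, HeckeCharacter.localComponent_apply,
    HeckeCharacter.one_apply, Units.val_one]

/-- The Euler factor denominator `1 - q_v^{-s}` of `ζ_K` does not vanish for `Re s > 0`. [folklore] -/
theorem one_sub_residueCard_cpow_neg_ne_zero {K : Type*} [Field K] [NumberField K]
    (v : HeightOneSpectrum (𝓞 K)) {s : ℂ} (hs : 0 < s.re) :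
    1 - ((v.residueCard : ℂ) ^ (-s)) ≠ 0 := by
  have h := one_sub_valueAtUniformizer_mul_cpow_ne_zero (HeckeCharacter.isUnitary_one (K := K)) v hs
  rwa [HeckeCharacter.valueAtUniformizer_one', one_mul] at h

/-- `s ↦ 1 - q_v^{-s}` is continuous. [folklore] -/
theorem continuous_one_sub_residueCard_cpow_neg {K : Type*} [Field K] [NumberField K]
    (v : HeightOneSpectrum (𝓞 K)) : Continuous fun s : ℂ => 1 - ((v.residueCard : ℂ) ^ (-s)) := by
  have hq : (v.residueCard : ℂ) ≠ 0 :=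
    Nat.cast_ne_zero.2 (ne_of_gt (lt_trans zero_lt_one v.one_lt_residueCard))
  exact continuous_const.sub (continuous_neg.const_cpow (Or.inl hq))

/-- **The partial Riemann zeta function**: for a finite set `S` of places of `ℚ` and `Re s > 1`,
`ζ^S(s) = ∏'_{v ∉ S} (1 - p_v^{-s})⁻¹ = ζ(s) · ∏_{v ∈ S} (1 - p_v^{-s})` (Mathlib's Euler product
`riemannZeta_eulerProduct_hasProd`, reindexed along `Rat.HeightOneSpectrum.primesEquiv`, times the
finitely many inverted factors at `S`). [folklore] -/
theorem tprod_eulerFactor_one_eq_riemannZeta_mul_prod {S : Set (HeightOneSpectrum (𝓞 ℚ))}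
    (hS : S.Finite) {s : ℂ} (hs : 1 < s.re) :
    ∏' v : {v : HeightOneSpectrum (𝓞 ℚ) // v ∉ S}, (1 - ((v.1.residueCard : ℂ) ^ (-s)))⁻¹ =
      riemannZeta s * ∏ v ∈ hS.toFinset, (1 - ((v.residueCard : ℂ) ^ (-s))) := by
  classical
  have hres : ∀ v : HeightOneSpectrum (𝓞 ℚ), v.residueCard = natGenerator v :=
    Rat.residueCard_eq_natGenerator
  set f : HeightOneSpectrum (𝓞 ℚ) → ℂ := fun v => (1 - ((v.residueCard : ℂ) ^ (-s)))⁻¹ with hf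
  have hf0 : ∀ v, f v ≠ 0 := fun v =>
    inv_ne_zero (one_sub_residueCard_cpow_neg_ne_zero v (by linarith))
  have hζ : HasProd f (riemannZeta s) := by
    have h := (Equiv.hasProd_iff (primesEquiv (R := 𝓞 ℚ))).2 (riemannZeta_eulerProduct_hasProd hs)
    refine h.congr_fun fun v => ?_
    change f v = (1 - ((natGenerator v : ℂ) ^ (-s)))⁻¹
    rw [hf]
    dsimp only
    rw [hres v]
  have hfin : HasProd (S.mulIndicator fun v => (f v)⁻¹) (∏ v ∈ hS.toFinset, (f v)⁻¹) := by
    have h : HasProd (S.mulIndicator fun v => (f v)⁻¹)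
        (∏ v ∈ hS.toFinset, S.mulIndicator (fun v => (f v)⁻¹) v) :=
      hasProd_prod_of_ne_finset_one fun v hv =>
        Set.mulIndicator_of_notMem (fun hvS => hv (hS.mem_toFinset.2 hvS)) _
    rwa [Finset.prod_congr rfl fun v hv => Set.mulIndicator_of_mem (hS.mem_toFinset.1 hv) _] at h
  have hsplit : ∀ v, Sᶜ.mulIndicator f v = f v * S.mulIndicator (fun v => (f v)⁻¹) v := by
    intro v
    by_cases hvS : v ∈ S
    · rw [Set.mulIndicator_of_notMem (fun h => (Set.mem_compl_iff S v).1 h hvS),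
        Set.mulIndicator_of_mem hvS, mul_inv_cancel₀ (hf0 v)]
    · rw [Set.mulIndicator_of_mem (Set.mem_compl hvS), Set.mulIndicator_of_notMem hvS, mul_one]
  calc ∏' v : {v : HeightOneSpectrum (𝓞 ℚ) // v ∉ S}, f v.1
      = ∏' v, Sᶜ.mulIndicator f v := tprod_subtype Sᶜ f
    _ = ∏' v, f v * S.mulIndicator (fun v => (f v)⁻¹) v := tprod_congr hsplit
    _ = riemannZeta s * ∏ v ∈ hS.toFinset, (f v)⁻¹ := (hζ.mul hfin).tprod_eq
    _ = riemannZeta s * ∏ v ∈ hS.toFinset, (1 - ((v.residueCard : ℂ) ^ (-s))) := by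
      simp only [hf, inv_inv]

/-- **`ζ^S` has a simple pole at `s = 1`**: `(s - 1) ζ^S(s) → ∏_{v ∈ S} (1 - p_v^{-1}) ≠ 0` as
`s → 1`, `Re s > 1` (Mathlib `riemannZeta_residue_one`). This is Arthur–Clozel (2.3) for the pair
of trivial characters of `GL_1(𝔸_ℚ)`. [folklore] -/
theorem tendsto_sub_one_mul_tprod_eulerFactor_one {S : Set (HeightOneSpectrum (𝓞 ℚ))}
    (hS : S.Finite) :
    ∃ c : ℂ, c ≠ 0 ∧ Tendsto (fun s : ℂ => (s - 1) *
      ∏' v : {v : HeightOneSpectrum (𝓞 ℚ) // v ∉ S}, (1 - ((v.1.residueCard : ℂ) ^ (-s)))⁻¹)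
      (𝓝[{s : ℂ | 1 < s.re}] 1) (𝓝 c) := by
  classical
  set E : ℂ → ℂ := fun s => ∏ v ∈ hS.toFinset, (1 - ((v.residueCard : ℂ) ^ (-s))) with hE
  have hEcont : ContinuousAt E 1 := by
    change Tendsto E (𝓝 1) (𝓝 (E 1))
    exact tendsto_finsetProd _ fun v _ =>
      (continuous_one_sub_residueCard_cpow_neg v).continuousAt.tendsto
  have hE1 : E 1 ≠ 0 := Finset.prod_ne_zero_iff.2 fun v _ =>
    one_sub_residueCard_cpow_neg_ne_zero v (by norm_num)
  refine ⟨1 * E 1, by rwa [one_mul], ?_⟩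
  have hζ : Tendsto (fun s => (s - 1) * riemannZeta s) (𝓝[{s : ℂ | 1 < s.re}] 1) (𝓝 1) :=
    riemannZeta_residue_one.mono_left (nhdsWithin_mono _ fun s hs h1 => by
      rw [Set.mem_setOf_eq, (h1 : s = 1), Complex.one_re] at hs
      exact lt_irrefl _ hs)
  have hlim := hζ.mul (hEcont.tendsto.mono_left nhdsWithin_le_nhds)
  refine hlim.congr' (eventually_nhdsWithin_of_forall fun s hs => ?_)
  change ((s - 1) * riemannZeta s) * E s = (s - 1) * _
  rw [tprod_eulerFactor_one_eq_riemannZeta_mul_prod hS hs, mul_assoc]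

/-- **`ζ^S` is continuous and non-zero at the points `s₀ ≠ 1` of `Re s ≥ 1`**: `ζ^S(s) →
ζ(s₀) ∏_{v ∈ S} (1 - p_v^{-s₀}) ≠ 0` as `s → s₀`, `Re s > 1` (Mathlib `differentiableAt_riemannZeta`,
`riemannZeta_ne_zero_of_one_le_re`: `ζ(1 + it) ≠ 0`). This is Arthur–Clozel (2.2) off `s = 1` for the
pair of trivial characters of `GL_1(𝔸_ℚ)`. [folklore] -/
theorem tendsto_tprod_eulerFactor_one_of_ne_one {S : Set (HeightOneSpectrum (𝓞 ℚ))}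
    (hS : S.Finite) {s₀ : ℂ} (hs₀ : 1 ≤ s₀.re) (hs₁ : s₀ ≠ 1) :
    ∃ c : ℂ, c ≠ 0 ∧ Tendsto (fun s : ℂ =>
      ∏' v : {v : HeightOneSpectrum (𝓞 ℚ) // v ∉ S}, (1 - ((v.1.residueCard : ℂ) ^ (-s)))⁻¹)
      (𝓝[{s : ℂ | 1 < s.re}] s₀) (𝓝 c) := by
  classical
  have hs₀' : 0 < s₀.re := by linarith
  set E : ℂ → ℂ := fun s => ∏ v ∈ hS.toFinset, (1 - ((v.residueCard : ℂ) ^ (-s))) with hE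
  have hEcont : ContinuousAt E s₀ := by
    change Tendsto E (𝓝 s₀) (𝓝 (E s₀))
    exact tendsto_finsetProd _ fun v _ =>
      (continuous_one_sub_residueCard_cpow_neg v).continuousAt.tendsto
  have hE1 : E s₀ ≠ 0 := Finset.prod_ne_zero_iff.2 fun v _ =>
    one_sub_residueCard_cpow_neg_ne_zero v hs₀'
  have hζcont : ContinuousAt riemannZeta s₀ := (differentiableAt_riemannZeta hs₁).continuousAt
  have hζ0 : riemannZeta s₀ ≠ 0 := riemannZeta_ne_zero_of_one_le_re hs₀
  refine ⟨riemannZeta s₀ * E s₀, mul_ne_zero hζ0 hE1, ?_⟩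
  have hlim : Tendsto (fun s => riemannZeta s * E s) (𝓝[{s : ℂ | 1 < s.re}] s₀)
      (𝓝 (riemannZeta s₀ * E s₀)) :=
    (hζcont.mul hEcont).tendsto.mono_left nhdsWithin_le_nhds
  refine hlim.congr' (eventually_nhdsWithin_of_forall fun s hs => ?_)
  exact (tprod_eulerFactor_one_eq_riemannZeta_mul_prod hS hs).symm

/-! ### Hecke–Landau for `ℚ` (Dirichlet), in the tree's limit rendering -/

/-- **Non-vanishing and continuity of partial Hecke `L`-functions of `ℚ` on `Re s ≥ 1`** (Dirichlet's
theorem `L(1, χ) ≠ 0`, with `L(1 + it, χ) ≠ 0`; Hecke–Landau for `K = ℚ`), in the limit rendering of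
`PairLFunctionPoles`: for a unitary Hecke character `ψ ≠ 1` of `ℚ` trivial on `ℝ_{>0}`, a finite set
`S` of places and `Re s₀ ≥ 1`, `L^S(s, ψ) = ∏'_{v ∉ S} (1 - ψ(ϖ_v) q_v^{-s})⁻¹` has a finite
**non-zero** limit as `s → s₀`, `Re s > 1`. Proof: `ψ` has finite order (`AutomorphicGRHOne.isFiniteOrder_of_map_posRealIdele`),
hence comes from a Dirichlet character `d` mod `m` (`exists_dirichletCharacter_of_isFiniteOrder_holds`),
`L^S(s, ψ) = L(s, d_N) E(s)` on `Re s > 1` with `E` a finite Euler product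
(`tprod_eulerFactor_eq_LSeries_mul_prod`); `d_N ≠ 1` because `ψ ≠ 1`
(`HeckeCharacter.Rat.eq_one_of_forall`), so `L(s, d_N)` is entire (Mathlib
`DirichletCharacter.differentiable_LFunction`) with `L(s₀, d_N) ≠ 0` (Dirichlet; Mathlib
`DirichletCharacter.LFunction_ne_zero_of_one_le_re`), and `E` is continuous at `s₀` with
`E(s₀) ≠ 0` (`|ψ(ϖ_p)| = 1 < p^{Re s₀}`). [folklore] -/
theorem heckeLandau_rat (ψ : HeckeCharacter ℚ) (hu : ψ.IsUnitary)
    (hA : ∀ t : ℝ≥0ˣ, ψ (posRealIdele ℚ t) = 1) (h1 : ψ ≠ 1)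
    {S : Set (HeightOneSpectrum (𝓞 ℚ))} (hS : S.Finite) {s₀ : ℂ} (hs₀ : 1 ≤ s₀.re) :
    ∃ c : ℂ, c ≠ 0 ∧ Tendsto (fun s : ℂ => ∏' v : {v : HeightOneSpectrum (𝓞 ℚ) // v ∉ S},
      (1 - ψ.valueAtUniformizer v.1 * ((v.1.residueCard : ℂ) ^ (-s)))⁻¹)
      (𝓝[{s : ℂ | 1 < s.re}] s₀) (𝓝 c) := by
  classical
  have hs₀' : 0 < s₀.re := by linarith
  have hfin : ψ.IsFiniteOrder :=
    Literature.NumberTheory.LFunctions.AutomorphicGRHOne.isFiniteOrder_of_map_posRealIdele ψ hA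
  obtain ⟨m, hm, d, hd⟩ := HeckeCharacter.exists_dirichletCharacter_of_isFiniteOrder_holds ψ hfin
  -- the level `N = m ∏_{v ∈ S} p_v` and the imprimitive character `d_N`
  set P : ℕ := ∏ v ∈ hS.toFinset, natGenerator v with hP
  have hP0 : P ≠ 0 := Finset.prod_ne_zero_iff.2 fun v _ => (prime_natGenerator v).ne_zero
  haveI hN : NeZero (m * P) := ⟨mul_ne_zero (NeZero.ne m) hP0⟩
  set d' : DirichletCharacter ℂ (m * P) := DirichletCharacter.changeLevel (dvd_mul_right m P) d
    with hd'
  have hres : ∀ v : HeightOneSpectrum (𝓞 ℚ), v.residueCard = natGenerator v :=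
    Rat.residueCard_eq_natGenerator
  -- `d_N ≠ 1` since `ψ ≠ 1`
  have hd'1 : d' ≠ 1 := by
    intro hd1
    apply h1
    refine HeckeCharacter.Rat.eq_one_of_forall (ψ := ψ) (m := m * P) hfin fun v hv => ?_
    have hvm : ¬ natGenerator v ∣ m := fun h => hv (h.mul_right P)
    obtain ⟨hunr, hval⟩ := hd v ((Rat.natCast_mem_asIdeal_iff v).not.2 hvm)
    refine ⟨hunr, ?_⟩
    have hq : IsUnit ((natGenerator v : ℕ) : ZMod (m * P)) :=
      (ZMod.isUnit_prime_iff_not_dvd (prime_natGenerator v)).mpr hv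
    have hdd : d' (natGenerator v) = d (natGenerator v) := by
      rw [← hq.unit_spec, hd', DirichletCharacter.changeLevel_eq_cast_of_dvd d _ hq.unit,
        hq.unit_spec, ZMod.cast_natCast (dvd_mul_right m P)]
    rw [hval, hres v, ← hdd, hd1, MulChar.one_apply hq]
  -- the exceptional finite set `F = {v ∉ S : p_v ∣ m}`
  set F : Set (HeightOneSpectrum (𝓞 ℚ)) := {v | v ∉ S ∧ natGenerator v ∣ m} with hFdef
  have hF : F.Finite := by
    refine ((m.primeFactors : Set ℕ).toFinite.preimage Rat.natGenerator_injective.injOn).subset ?_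
    intro v hv
    exact Nat.mem_primeFactors.2 ⟨prime_natGenerator v, hv.2, NeZero.ne m⟩
  -- the finite Euler product `E` and the candidate limit
  set E : ℂ → ℂ := fun s => ∏ v ∈ hF.toFinset,
    (1 - ψ.valueAtUniformizer v * ((v.residueCard : ℂ) ^ (-s)))⁻¹ with hE
  have hEcont : ContinuousAt E s₀ := by
    change Tendsto E (𝓝 s₀) (𝓝 (E s₀))
    exact tendsto_finsetProd _ fun v _ =>
      (differentiableAt_eulerFactor hu v hs₀').continuousAt.tendsto
  have hE1 : E s₀ ≠ 0 := Finset.prod_ne_zero_iff.2 fun v _ =>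
    inv_ne_zero (one_sub_valueAtUniformizer_mul_cpow_ne_zero hu v hs₀')
  have hLcont : ContinuousAt (fun s => d'.LFunction s) s₀ :=
    (DirichletCharacter.differentiable_LFunction hd'1).continuous.continuousAt
  have hL1 : d'.LFunction s₀ ≠ 0 :=
    DirichletCharacter.LFunction_ne_zero_of_one_le_re d' (Or.inl hd'1) hs₀
  refine ⟨d'.LFunction s₀ * E s₀, mul_ne_zero hL1 hE1, ?_⟩
  have hlim : Tendsto (fun s => d'.LFunction s * E s) (𝓝[{s : ℂ | 1 < s.re}] s₀)
      (𝓝 (d'.LFunction s₀ * E s₀)) :=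
    (hLcont.mul hEcont).tendsto.mono_left nhdsWithin_le_nhds
  refine hlim.congr' (eventually_nhdsWithin_of_forall fun s hs => ?_)
  rw [DirichletCharacter.LFunction_eq_LSeries d' hs]
  exact (tprod_eulerFactor_eq_LSeries_mul_prod ψ d hd hS hF (fun v => Iff.rfl) hs).symm

end Rat

end Literature.NumberTheory.GaloisRepresentations

/-! ### Arthur–Clozel (2.2) at `s = 1` for `GL_1` over `ℚ` -/

namespace Literature.NumberTheory.Automorphic

open AdelicGroupData GaloisRepresentations

/-- **Arthur–Clozel (2.2) at `s₀ = 1`, rank one over `ℚ`, unconditionally.** For cuspidal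
automorphic representations `π, π'` of `GL_1(𝔸_ℚ)` in `L²_cusp(GL_1(ℚ) ℝ_{>0} \ GL_1(𝔸_ℚ))` with
`π ≠ π̄'` (`π ≇ σ̃`), honest Satake families `α`, `β` off a finite set `S` of places, the partial
Rankin–Selberg `L`-function `L^S(s, π × π') = L^S(s, χ_π χ_{π'})` has a finite non-zero limit as
`s → 1`, `Re s > 1`: the named fact `JacquetShalika1981_partialPairL_at_one_of_ne_conj` for `n = 1`,
`K = ℚ`, by the reduction to Hecke characters (`…_one_of_heckeCharacter`) and Dirichlet's theorem
(`heckeLandau_rat`). [cite: ArthurClozelAMS120, Ch. 3 §2 (2.2)] -/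
theorem JacquetShalika1981_partialPairL_at_one_of_ne_conj_one_rat
    {μ : Measure (gl 1 ℚ).automorphicQuotient} [(gl 1 ℚ).IsAutomorphicMeasure μ] :
    JacquetShalika1981_partialPairL_at_one_of_ne_conj (n := 1) (K := ℚ) (μ := μ) :=
  JacquetShalika1981_partialPairL_at_one_of_ne_conj_one_of_heckeCharacter
    fun ψ hu hA h1 _ hS _ => heckeLandau_rat ψ hu hA h1 hS (by norm_num)

/-! ### The companions (2.3) and (2.2) off `s = 1`, for `GL_1` over `ℚ` -/

/-- The `GL_1` dictionary for the pair `L`-function with the two representations in possibly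
different automorphic measures `μ`, `μ'` (the binder shape of
`JacquetShalika1981_partialPairL_boundary_of_ne_one`): `L^S(s, π × π') = L^S(s, χ_π χ_{π'})`
(`CuspidalAutomorphicRepGL.partialPairL_eq_tprod_heckeCharacter` is the case `μ' = μ`). [folklore] -/
theorem CuspidalAutomorphicRepGL.partialPairL_eq_tprod_heckeCharacter₂ {K : Type} [Field K]
    [NumberField K] {μ μ' : Measure (gl 1 K).automorphicQuotient} [(gl 1 K).IsAutomorphicMeasure μ]
    [(gl 1 K).IsAutomorphicMeasure μ'] {P : CuspidalAutomorphicRepGL 1 K μ}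
    {P' : CuspidalAutomorphicRepGL 1 K μ'} {S : Set (HeightOneSpectrum (𝓞 K))} {α β : SatakeFamily K}
    (hα : IsSatakeFamilyOf P S α) (hβ : IsSatakeFamilyOf P' S β) (s : ℂ) :
    partialPairL S α β s = ∏' v : {v : HeightOneSpectrum (𝓞 K) // v ∉ S},
      (1 - (P.heckeCharacter * P'.heckeCharacter).valueAtUniformizer v.1 *
        ((v.1.residueCard : ℂ) ^ (-s)))⁻¹ := by
  unfold partialPairL
  refine tprod_congr fun v => ?_
  rw [hα.eq_singleton_valueAtUniformizer v.2, hβ.eq_singleton_valueAtUniformizer v.2,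
    eval_satakePairPolynomial_singleton, HeckeCharacter.valueAtUniformizer_mul]

/-- **Arthur–Clozel (2.3), rank one over `ℚ`, unconditionally**: for cuspidal `π, π'` of
`GL_1(𝔸_ℚ)` (same `L²_cusp`) with `π = π̄'` (`π ≅ σ̃`) and honest Satake families off a finite `S`,
`(s - 1) L^S(s, π × π')` has a finite non-zero limit as `s → 1`, `Re s > 1`: here
`χ_π χ_{π'} = χ_{π'}⁻¹ χ_{π'} = 1` (`heckeCharacter_conj`), `L^S(s, π × π') = ζ^S(s)`, and `ζ^S` has a
simple pole at `1` (`tendsto_sub_one_mul_tprod_eulerFactor_one`, Mathlib `riemannZeta_residue_one`).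
The named fact `JacquetShalika1981_partialPairL_pole_of_eq_conj` for `n = 1`, `K = ℚ`.
[cite: ArthurClozelAMS120, Ch. 3 §2 (2.3)] -/
theorem JacquetShalika1981_partialPairL_pole_of_eq_conj_one_rat
    {μ : Measure (gl 1 ℚ).automorphicQuotient} [(gl 1 ℚ).IsAutomorphicMeasure μ] :
    JacquetShalika1981_partialPairL_pole_of_eq_conj (n := 1) (K := ℚ) (μ := μ) := by
  intro _ P P' he S hS α β hα hβ
  have hψ : P.heckeCharacter * P'.heckeCharacter = 1 := by
    rw [he, CuspidalAutomorphicRepGL.heckeCharacter_conj, inv_mul_cancel]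
  obtain ⟨c, hc, hlim⟩ := tendsto_sub_one_mul_tprod_eulerFactor_one hS
  refine ⟨c, hc, ?_⟩
  have hfun : (fun s : ℂ => (s - 1) * partialPairL S α β s) = fun s : ℂ => (s - 1) *
      ∏' v : {v : HeightOneSpectrum (𝓞 ℚ) // v ∉ S}, (1 - ((v.1.residueCard : ℂ) ^ (-s)))⁻¹ := by
    funext s
    rw [CuspidalAutomorphicRepGL.partialPairL_eq_tprod_heckeCharacter hα hβ, hψ]
    simp only [HeckeCharacter.valueAtUniformizer_one', one_mul]
  rw [hfun]
  exact hlim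

/-- **Arthur–Clozel (2.2) at the points `s₀ ≠ 1` of `Re s = 1`, ranks `n = m = 1` over `ℚ`,
unconditionally**: for cuspidal `π` (measure `μ`) and `π'` (measure `μ'`) of `GL_1(𝔸_ℚ)` with honest
Satake families off a finite `S`, and `Re s₀ = 1`, `s₀ ≠ 1`, `L^S(s, π × π') = L^S(s, χ_π χ_{π'})` has a
finite non-zero limit as `s → s₀`, `Re s > 1`: for `χ_π χ_{π'} = 1` this is `ζ^S(s₀) ≠ 0`
(`ζ(1 + it) ≠ 0`, `tendsto_tprod_eulerFactor_one_of_ne_one`), otherwise Dirichlet's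
`L(1 + it, ψ) ≠ 0` (`heckeLandau_rat`). The named fact
`JacquetShalika1981_partialPairL_boundary_of_ne_one` for `n = m = 1`, `K = ℚ`.
[cite: ArthurClozelAMS120, Ch. 3 §2 (2.2)] -/
theorem JacquetShalika1981_partialPairL_boundary_of_ne_one_one_rat
    {μ μ' : Measure (gl 1 ℚ).automorphicQuotient} [(gl 1 ℚ).IsAutomorphicMeasure μ]
    [(gl 1 ℚ).IsAutomorphicMeasure μ'] :
    JacquetShalika1981_partialPairL_boundary_of_ne_one (n := 1) (m := 1) (K := ℚ) (μ := μ)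
      (μ' := μ') := by
  intro _ _ P P' S hS α β hα hβ s₀ hs₀ hs₁
  have hfun : partialPairL S α β = fun s : ℂ => ∏' v : {v : HeightOneSpectrum (𝓞 ℚ) // v ∉ S},
      (1 - (P.heckeCharacter * P'.heckeCharacter).valueAtUniformizer v.1 *
        ((v.1.residueCard : ℂ) ^ (-s)))⁻¹ :=
    funext (CuspidalAutomorphicRepGL.partialPairL_eq_tprod_heckeCharacter₂ hα hβ)
  by_cases hψ : P.heckeCharacter * P'.heckeCharacter = 1
  · obtain ⟨c, hc, hlim⟩ := tendsto_tprod_eulerFactor_one_of_ne_one hS (le_of_eq hs₀.symm) hs₁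
    refine ⟨c, hc, ?_⟩
    rw [hfun, hψ]
    simp only [HeckeCharacter.valueAtUniformizer_one', one_mul]
    exact hlim
  · obtain ⟨c, hc, hlim⟩ := heckeLandau_rat _
      (P.isUnitary_heckeCharacter.mul P'.isUnitary_heckeCharacter)
      (fun t => by rw [HeckeCharacter.mul_apply, P.heckeCharacter_posRealIdele,
        P'.heckeCharacter_posRealIdele, one_mul]) hψ hS (le_of_eq hs₀.symm)
    refine ⟨c, hc, ?_⟩
    rw [hfun]
    exact hlim

end Literature.NumberTheory.Automorphic
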